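import Literature.NumberTheory.Automorphic.CompactCoreLevelPoint
import Literature.NumberTheory.Automorphic.LocalCentralizerUnimodularOfAdelic
import Literature.NumberTheory.Automorphic.UnitaryGroupOrbitalMeasureOfLocalQuotient
import Literature.NumberTheory.Automorphic.CompactCoreCentralizerLevelOfIntegralConjugacy
import Literature.MeasureTheory.Group.InvariantQuotientOrbitalTransport
import Literature.NumberTheory.Rogawski1990.RegularEltLocalisation
import Literature.NumberTheory.Automorphic.UnitaryGroupAdelicHaarOfLocal
import HarnessLib

/-!
# The LOCAL TORUS PACKAGE of a canonical orbital-measure family: the model-side data `t′_v, hm, hν1, ht1, hm1` of ★ (b3)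
(Rogawski (1990), §4.3 pp. 43–44: «the measures `dt_v` on `T(F_v)` normalised by `T(𝒪_v)` for almost all `v`»; §5.4 p. 72)

Topic `NumberTheory/Automorphic`; namespace `Literature.NumberTheory.Automorphic.UnitaryGroup`.  THEOREMS ONLY: no definition, no instance, no named fact,
no `sorry`.  Cell `pub/hodgecm-mathlib`, ENGINE T1 (crux item stmt-HodgeConjecture-24833), row (O10-c2a) of F0P3a-plan (g4) GO #97∕#98 (author F0P2-p02 (g3);
consumer (O10-c2b) «tower assembly», F0P3a-p06 (g4)).

★ (b3) `UnitaryGroup.adelicOrbitalMeasureOfLocal_quotientMeasure_eq` identifies `ofLocal (dg_∞∕dt_∞, dg_v∕dt_v)` with `dg∕dt` on `U(H)(𝔸)⧸C(g)` once, at every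
finite place `v`, one supplies on the MODEL side (`localPi v`, `ψ_v = localPiEquiv v`, model torus `Z′_v = C((g_f)_v)`): a torus measure `t′_v` with the transport
identity `hm`, and, off ONE finite set `S₀`, the three normalisations `hν1` (`ν′_v(U(𝒪_v)) = 1`), `ht1` (`t′_v(Z′_v ∩ U(𝒪_v)) = 1`), `hm1`
(`(ν′_v∕t′_v)(π U(𝒪_v)) = 1`).  This file produces all of them from a family `mG v` CANONICAL on the regular classes (the T1 line's pin (xi‴)):

* §0 `localPiEquiv_symm_toLocal`, **`localPiEquiv_symm_mem_centralizer_iff`** — `(ψ_v)⁻¹` maps `C(g_v)` onto the model torus `C((g_f)_v)` (the `hC` of (b3)).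
* §1 **`exists_torusMeasure_atPoint_eq`** — at a regular `g_v`, a canonical `mG v` reads `(mG v).atPoint g_v = ν_v ∕ t` for a Haar, inversion-invariant `t`
  on `C(g_v)` with `t(compactCore) = 1` (★ `IsCanonical.atPoint_eq_quotientMeasure`).
* §2 for ANY such `t`, with the LITERAL transports `t′ := (ψ_v⁻¹|)_* t`, `ν′ := (ψ_v⁻¹)_* ν_v` (so that a consumer binds them by `rfl`):
  `isHaarMeasure_torusTransport` ∕ `isInvInvariant_torusTransport` ∕ `isMulRightInvariant_map_localPiEquiv_symm` (instances, §2a; `IsHaarMeasure ν′` is ★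
  `isHaarMeasure_map_localModel_symm` of `UnitaryGroupAdelicHaarOfLocal`); **`map_cosetCongr_quotientMeasure_torusTransport`** (`hm`, §2b, ★ `map_cosetCongr_quotientMeasure`); ★ `map_localPiEquiv_symm_apply_localInt` of
  `UnitaryGroupAdelicHaarOfLocal` (`hν1`, F0P4-p03 (g4), imported — §2c); **`torusTransport_apply_inH`** ∕ **`torusTransport_apply_inH_eq_one`** (`ht1`: `t′(inH) = t(C(g_v) ∩ U(H)(𝒪_v))`, `= 1` when
  `compactCore ⊆ U(H)(𝒪_v)`, ★ `measure_preimage_eq_one_of_compactCore_subset`, §2d); **`quotientMeasure_torusTransport_quotBase_eq_one`** (`hm1`: the model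
  quotient measure gives `π(localInt)` mass `1` under `ν_v(U(H)(𝒪_v)) = 1` and the same inclusion, ★ `quotientMeasure_image_mk_eq_one`, §2e).
* §3 **`exists_finset_compactCore_centralizer_subset`** (+ `_of_hermitian`) — for `g = γ ⊗ 1`, `γ` regular rational, the inclusion `compactCore C(g_v) ⊆ U(H)(𝒪_v)` holds for all
  but finitely many `v` (★ `CompactCoreCentralizerLevelAE`, discharged at hermitian non-degenerate `H` by ★ `compactCoreCentralizerLevelAE_of_hermitian`),
  and its `∃ S₀` form.
HC_CM is proved only modulo the printed citations until rung 0 closes; this file proves no printed citation (measure-theoretic plumbing).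

## References
* [Rogawski1990] J. D. Rogawski, *Automorphic Representations of Unitary Groups in Three Variables*, Ann. of Math. Stud. 123 (1990), §4.3 pp. 43–44, §5.4 p. 72.
* [DeitmarEchterhoff2014] A. Deitmar, S. Echterhoff, *Principles of Harmonic Analysis*, 2nd ed. (2014), Thm. 1.5.3 (quotient measures).
* [PlatonovRapinchuk1994] V. Platonov, A. Rapinchuk, *Algebraic Groups and Number Theory* (1994), §5.1 (`U(𝒪_v)` at the places of a number field).
-/

set_option autoImplicit false

noncomputable section

open _root_.MeasureTheory _root_.MeasureTheory.Measure Set Filter Function NumberField IsDedekindDomain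
open _root_.Topology
open Literature.Topology.RestrictedProduct Literature.Topology.Algebra.RestrictedProduct Literature.MeasureTheory.Group
open scoped RestrictedProduct ENNReal NNReal Pointwise Matrix

namespace Literature.NumberTheory.Automorphic

namespace UnitaryGroup

variable (L : Type) [Field L] [NumberField L] [IsCMField L] (N : ℕ) (H : Matrix (Fin N) (Fin N) L)
  (v : HeightOneSpectrum (𝓞 ↥(maximalRealSubfield L))) (g : (cmDatum L N H).Adelic)
  -- the local congruence, as an EXPRESSION with its equation (the (b3) convention `(ψ) (hψ : ψ = fun v => localPiEquiv … v)`, read at `v`)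
  (ψ : ↥(localPi L (IsCMField.complexConj L) N H v) ≃ₜ* (cmDatum L N H).Local v) (hψ : ψ = localPiEquiv L (IsCMField.complexConj L) N H v)

/-! ## §0 `(ψ_v)⁻¹` carries `C(g_v)` onto the model torus `C((g_f)_v)` -/

include hψ in
/-- `(ψ_v)⁻¹ (g_v) = (g_f)_v` — the datum's local component is the place-`v` retraction (★ `cmDatum_toLocal_eq_localPiEquiv`).
[cite: PlatonovRapinchuk1994, §5.1] -/
theorem localPiEquiv_symm_toLocal :
    ψ.symm.toMulEquiv ((cmDatum L N H).toLocal v g) =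
      finAdelicEquiv (↥(maximalRealSubfield L)) L (IsCMField.complexConj L) N H
        (finPart (↥(maximalRealSubfield L)) L (IsCMField.complexConj L) N H g) v := by
  subst hψ
  show (localPiEquiv L (IsCMField.complexConj L) N H v).symm ((cmDatum L N H).toLocal v g) = _
  rw [cmDatum_toLocal_eq_localPiEquiv L H v g, ContinuousMulEquiv.symm_apply_apply]
  rfl

include hψ in
/-- **The `hC` of ★ (b3)**: `(ψ_v)⁻¹ x ∈ C((g_f)_v) ↔ x ∈ C(g_v)`. [cite: PlatonovRapinchuk1994, §5.1] -/
theorem localPiEquiv_symm_mem_centralizer_iff :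
    ∀ x : (cmDatum L N H).Local v, ψ.symm.toMulEquiv x ∈ Subgroup.centralizer ({finAdelicEquiv (↥(maximalRealSubfield L)) L (IsCMField.complexConj L) N H (finPart (↥(maximalRealSubfield L)) L (IsCMField.complexConj L) N H g) v} : Set ↥(localPi L (IsCMField.complexConj L) N H v)) ↔ x ∈ Subgroup.centralizer ({((cmDatum L N H).toLocal v g)} : Set ((cmDatum L N H).Local v)) :=
  forall_apply_mem_centralizer_singleton_iff_of_eq ψ.symm.toMulEquiv (localPiEquiv_symm_toLocal L N H v g ψ hψ)

/-! ## §1 The local torus measure of a canonical family at a regular point -/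

section LocalA

variable [MeasurableSpace ((cmDatum L N H).Local v)] [BorelSpace ((cmDatum L N H).Local v)] [SecondCountableTopology ((cmDatum L N H).Local v)]
  [∀ x : (cmDatum L N H).Local v, MeasurableSpace ((cmDatum L N H).Local v ⧸ Subgroup.centralizer ({x} : Set ((cmDatum L N H).Local v)))]
  [∀ x : (cmDatum L N H).Local v, BorelSpace ((cmDatum L N H).Local v ⧸ Subgroup.centralizer ({x} : Set ((cmDatum L N H).Local v)))]

/-- **The local torus measure at a regular point.**  If `m` is canonical on the regular classes for the Haar measure `ν` and `g_v` is regular, then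
`m.atPoint g_v = ν ∕ t` on `U(H)(L⁺_v) ⧸ C(g_v)` for a Haar, inversion-invariant measure `t` on the torus `C(g_v)` giving its compact core mass one
(★ `IsCanonical.atPoint_eq_quotientMeasure`; regularity of `out ⟦g_v⟧` by ★ `isRegularElt_out_mk_local`). [cite: Rogawski1990, §4.3 p. 43]
[cite: DeitmarEchterhoff2014, Thm. 1.5.3] -/
theorem exists_torusMeasure_atPoint_eq {ν : Measure ((cmDatum L N H).Local v)} [ν.IsHaarMeasure] [ν.IsMulRightInvariant]
    {m : OrbitalMeasureFamily ((cmDatum L N H).Local v)}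
    (hcan : m.IsCanonical (fun x => Rogawski1990.IsRegularElt (x.val : GL (Fin N) (LocalRing L v))) ν)
    (hreg : Rogawski1990.IsRegularElt (((cmDatum L N H).toLocal v g).val : GL (Fin N) (LocalRing L v))) :
    ∃ t : Measure (Subgroup.centralizer ({((cmDatum L N H).toLocal v g)} : Set ((cmDatum L N H).Local v))), ∃ (_ : t.IsHaarMeasure) (_ : t.IsInvInvariant),
      t (compactCore (Subgroup.centralizer ({((cmDatum L N H).toLocal v g)} : Set ((cmDatum L N H).Local v)))) = 1 ∧
        m.atPoint ((cmDatum L N H).toLocal v g) = quotientMeasure (Subgroup.centralizer ({((cmDatum L N H).toLocal v g)} : Set ((cmDatum L N H).Local v))) t (isClosed_coe_centralizer_singleton _) ν :=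
  hcan.atPoint_eq_quotientMeasure _ (Rogawski1990.isRegularElt_out_mk_local hreg)

end LocalA

/-! ## §2 The model-side transports `t′ := (ψ_v⁻¹|)_* t`, `ν′ := (ψ_v⁻¹)_* ν_v` and the four (b3) clauses -/

section Transport

variable [MeasurableSpace ((cmDatum L N H).Local v)] [BorelSpace ((cmDatum L N H).Local v)]
  [MeasurableSpace ↥(localPi L (IsCMField.complexConj L) N H v)] [BorelSpace ↥(localPi L (IsCMField.complexConj L) N H v)]

section TransportA

include hψ in
/-- §2a: **`t′ := (ψ_v⁻¹|)_* t` is a Haar measure** on the model torus (★ `isHaarMeasure_map_subgroupCongrHomeomorph`). [cite: Rogawski1990, §4.3 p. 43] -/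
theorem isHaarMeasure_torusTransport (t : Measure (Subgroup.centralizer ({((cmDatum L N H).toLocal v g)} : Set ((cmDatum L N H).Local v)))) [t.IsHaarMeasure] :
    IsHaarMeasure (Measure.map (subgroupCongrHomeomorph ψ.symm.toMulEquiv (Subgroup.centralizer ({((cmDatum L N H).toLocal v g)} : Set ((cmDatum L N H).Local v)))
        (Subgroup.centralizer ({finAdelicEquiv (↥(maximalRealSubfield L)) L (IsCMField.complexConj L) N H (finPart (↥(maximalRealSubfield L)) L (IsCMField.complexConj L) N H g) v} : Set ↥(localPi L (IsCMField.complexConj L) N H v)))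
        (localPiEquiv_symm_mem_centralizer_iff L N H v g ψ hψ) ψ.symm.continuous ψ.continuous) t) := by
  haveI : LocallyCompactSpace (Subgroup.centralizer ({((cmDatum L N H).toLocal v g)} : Set ((cmDatum L N H).Local v))) := (isClosed_coe_centralizer_singleton _).isClosedEmbedding_subtypeVal.locallyCompactSpace
  exact isHaarMeasure_map_subgroupCongrHomeomorph _ _ _ _ _ _ t

include hψ in
/-- §2a: `t′` is inversion invariant when `t` is (★ `isInvInvariant_map_subgroupCongrHomeomorph`). [cite: Rogawski1990, §4.3 p. 43] -/
theorem isInvInvariant_torusTransport (t : Measure (Subgroup.centralizer ({((cmDatum L N H).toLocal v g)} : Set ((cmDatum L N H).Local v)))) [t.IsInvInvariant] :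
    (Measure.map (subgroupCongrHomeomorph ψ.symm.toMulEquiv (Subgroup.centralizer ({((cmDatum L N H).toLocal v g)} : Set ((cmDatum L N H).Local v)))
        (Subgroup.centralizer ({finAdelicEquiv (↥(maximalRealSubfield L)) L (IsCMField.complexConj L) N H (finPart (↥(maximalRealSubfield L)) L (IsCMField.complexConj L) N H g) v} : Set ↥(localPi L (IsCMField.complexConj L) N H v)))
        (localPiEquiv_symm_mem_centralizer_iff L N H v g ψ hψ) ψ.symm.continuous ψ.continuous) t).IsInvInvariant :=
  isInvInvariant_map_subgroupCongrHomeomorph _ _ _ _ _ _ t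

omit hψ in
/-- §2a: `ν′` is right invariant when `ν_v` is (★ `isMulRightInvariant_map_mulEquiv_of_isMulRightInvariant`). [cite: Rogawski1990, §4.3 p. 43] -/
theorem isMulRightInvariant_map_localPiEquiv_symm (ν : Measure ((cmDatum L N H).Local v)) [ν.IsMulRightInvariant] :
    (Measure.map ψ.symm ν).IsMulRightInvariant :=
  isMulRightInvariant_map_mulEquiv_of_isMulRightInvariant ψ.symm.toMulEquiv ψ.symm.continuous.measurable ν

end TransportA

section TransportB

variable [SecondCountableTopology ((cmDatum L N H).Local v)]
  [LocallyCompactSpace ↥(localPi L (IsCMField.complexConj L) N H v)] [SecondCountableTopology ↥(localPi L (IsCMField.complexConj L) N H v)]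
  [MeasurableSpace ((cmDatum L N H).Local v ⧸ Subgroup.centralizer ({((cmDatum L N H).toLocal v g)} : Set ((cmDatum L N H).Local v)))] [BorelSpace ((cmDatum L N H).Local v ⧸ Subgroup.centralizer ({((cmDatum L N H).toLocal v g)} : Set ((cmDatum L N H).Local v)))]
  [MeasurableSpace (↥(localPi L (IsCMField.complexConj L) N H v) ⧸ Subgroup.centralizer ({finAdelicEquiv (↥(maximalRealSubfield L)) L (IsCMField.complexConj L) N H (finPart (↥(maximalRealSubfield L)) L (IsCMField.complexConj L) N H g) v} : Set ↥(localPi L (IsCMField.complexConj L) N H v)))]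
  [BorelSpace (↥(localPi L (IsCMField.complexConj L) N H v) ⧸ Subgroup.centralizer ({finAdelicEquiv (↥(maximalRealSubfield L)) L (IsCMField.complexConj L) N H (finPart (↥(maximalRealSubfield L)) L (IsCMField.complexConj L) N H g) v} : Set ↥(localPi L (IsCMField.complexConj L) N H v)))]

include hψ in
/-- §2b — **the `hm` of ★ (b3)**: `(cosetCongr ψ_v⁻¹)_* (ν_v ∕ t) = ν′ ∕ t′` for the transports `t′ = (ψ_v⁻¹|)_* t`, `ν′ = (ψ_v⁻¹)_* ν_v` (measures as
EXPRESSIONS with their equations `ht′`, `hν′`, the (b3) convention; their instances are §2a) — ★ `map_cosetCongr_quotientMeasure`, naturality of the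
quotient measure. [cite: DeitmarEchterhoff2014, Thm. 1.5.3] [cite: Rogawski1990, §4.3 p. 43] -/
theorem map_cosetCongr_quotientMeasure_torusTransport (ν : Measure ((cmDatum L N H).Local v)) [ν.IsHaarMeasure] [ν.IsMulRightInvariant]
    (ν' : Measure ↥(localPi L (IsCMField.complexConj L) N H v)) [ν'.IsHaarMeasure] [ν'.IsMulRightInvariant] (hν' : ν' = Measure.map ψ.symm ν)
    (t : Measure (Subgroup.centralizer ({((cmDatum L N H).toLocal v g)} : Set ((cmDatum L N H).Local v)))) [t.IsHaarMeasure] [t.IsInvInvariant]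
    (t' : Measure (Subgroup.centralizer ({finAdelicEquiv (↥(maximalRealSubfield L)) L (IsCMField.complexConj L) N H (finPart (↥(maximalRealSubfield L)) L (IsCMField.complexConj L) N H g) v} : Set ↥(localPi L (IsCMField.complexConj L) N H v))))
    [t'.IsMulLeftInvariant] [IsFiniteMeasureOnCompacts t'] [t'.IsOpenPosMeasure] [t'.IsInvInvariant] [SFinite t']
    (ht' : t' = Measure.map (subgroupCongrHomeomorph ψ.symm.toMulEquiv (Subgroup.centralizer ({((cmDatum L N H).toLocal v g)} : Set ((cmDatum L N H).Local v)))
        (Subgroup.centralizer ({finAdelicEquiv (↥(maximalRealSubfield L)) L (IsCMField.complexConj L) N H (finPart (↥(maximalRealSubfield L)) L (IsCMField.complexConj L) N H g) v} : Set ↥(localPi L (IsCMField.complexConj L) N H v)))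
        (localPiEquiv_symm_mem_centralizer_iff L N H v g ψ hψ) ψ.symm.continuous ψ.continuous) t) :
    Measure.map (cosetCongr ψ.symm.toMulEquiv (Subgroup.centralizer ({((cmDatum L N H).toLocal v g)} : Set ((cmDatum L N H).Local v))) (Subgroup.centralizer ({finAdelicEquiv (↥(maximalRealSubfield L)) L (IsCMField.complexConj L) N H (finPart (↥(maximalRealSubfield L)) L (IsCMField.complexConj L) N H g) v} : Set ↥(localPi L (IsCMField.complexConj L) N H v))) (localPiEquiv_symm_mem_centralizer_iff L N H v g ψ hψ))
        (quotientMeasure (Subgroup.centralizer ({((cmDatum L N H).toLocal v g)} : Set ((cmDatum L N H).Local v))) t (isClosed_coe_centralizer_singleton _) ν) =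
      quotientMeasure (Subgroup.centralizer ({finAdelicEquiv (↥(maximalRealSubfield L)) L (IsCMField.complexConj L) N H (finPart (↥(maximalRealSubfield L)) L (IsCMField.complexConj L) N H g) v} : Set ↥(localPi L (IsCMField.complexConj L) N H v))) t' (isClosed_coe_centralizer_singleton _) ν' := by
  haveI : LocallyCompactSpace (Subgroup.centralizer ({((cmDatum L N H).toLocal v g)} : Set ((cmDatum L N H).Local v))) := (isClosed_coe_centralizer_singleton _).isClosedEmbedding_subtypeVal.locallyCompactSpace
  haveI : IsClosed ((Subgroup.centralizer ({((cmDatum L N H).toLocal v g)} : Set ((cmDatum L N H).Local v))) : Set ((cmDatum L N H).Local v)) := isClosed_coe_centralizer_singleton _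
  haveI : IsClosed ((Subgroup.centralizer ({finAdelicEquiv (↥(maximalRealSubfield L)) L (IsCMField.complexConj L) N H (finPart (↥(maximalRealSubfield L)) L (IsCMField.complexConj L) N H g) v} : Set ↥(localPi L (IsCMField.complexConj L) N H v))) : Set ↥(localPi L (IsCMField.complexConj L) N H v)) := isClosed_coe_centralizer_singleton _
  exact map_cosetCongr_quotientMeasure ψ.symm.toMulEquiv ψ.symm.continuous ψ.continuous _ _ (localPiEquiv_symm_mem_centralizer_iff L N H v g ψ hψ) t t' ν ν' ht' hν'

end TransportB

/-! §2c — the `hν1` of ★ (b3) is ★ `map_localPiEquiv_symm_apply_localInt` ∕ `…_eq_one` of `UnitaryGroupAdelicHaarOfLocal` (F0P4-p03 (g4)); not restated. -/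

section TransportD

include hψ in
/-- §2d — **the `ht1` of ★ (b3)**: `t′ (C((g_f)_v) ∩ U(𝒪_v)) = t (C(g_v) ∩ U(H)(𝒪_v))` for `t′ = (ψ_v⁻¹|)_* t`. [cite: PlatonovRapinchuk1994, §5.1]
[cite: Rogawski1990, §4.3 p. 43] -/
theorem torusTransport_apply_inH (t : Measure (Subgroup.centralizer ({((cmDatum L N H).toLocal v g)} : Set ((cmDatum L N H).Local v)))) (t' : Measure (Subgroup.centralizer ({finAdelicEquiv (↥(maximalRealSubfield L)) L (IsCMField.complexConj L) N H (finPart (↥(maximalRealSubfield L)) L (IsCMField.complexConj L) N H g) v} : Set ↥(localPi L (IsCMField.complexConj L) N H v))))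
    (ht' : t' = Measure.map (subgroupCongrHomeomorph ψ.symm.toMulEquiv (Subgroup.centralizer ({((cmDatum L N H).toLocal v g)} : Set ((cmDatum L N H).Local v)))
        (Subgroup.centralizer ({finAdelicEquiv (↥(maximalRealSubfield L)) L (IsCMField.complexConj L) N H (finPart (↥(maximalRealSubfield L)) L (IsCMField.complexConj L) N H g) v} : Set ↥(localPi L (IsCMField.complexConj L) N H v)))
        (localPiEquiv_symm_mem_centralizer_iff L N H v g ψ hψ) ψ.symm.continuous ψ.continuous) t) :
    t' ((inH (fun v => localInt L (IsCMField.complexConj L) N H v)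
        (fun v => Subgroup.centralizer ({finAdelicEquiv (↥(maximalRealSubfield L)) L (IsCMField.complexConj L) N H
          (finPart (↥(maximalRealSubfield L)) L (IsCMField.complexConj L) N H g) v} : Set ↥(localPi L (IsCMField.complexConj L) N H v))) v :
          Subgroup (Subgroup.centralizer ({finAdelicEquiv (↥(maximalRealSubfield L)) L (IsCMField.complexConj L) N H (finPart (↥(maximalRealSubfield L)) L (IsCMField.complexConj L) N H g) v} : Set ↥(localPi L (IsCMField.complexConj L) N H v)))) : Set (Subgroup.centralizer ({finAdelicEquiv (↥(maximalRealSubfield L)) L (IsCMField.complexConj L) N H (finPart (↥(maximalRealSubfield L)) L (IsCMField.complexConj L) N H g) v} : Set ↥(localPi L (IsCMField.complexConj L) N H v)))) =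
      t (Subtype.val ⁻¹' (cmLocalIntegralLevel L N H v : Set ((cmDatum L N H).Local v))) := by
  subst ht'
  rw [← Homeomorph.toMeasurableEquiv_coe, MeasurableEquiv.map_apply]
  subst hψ
  rfl

include hψ in
/-- §2d′ — hence `t′ (C((g_f)_v) ∩ U(𝒪_v)) = 1` as soon as `t` gives the compact core of `C(g_v)` mass one and that compact core lies in `U(H)(𝒪_v)`
(★ `measure_preimage_eq_one_of_compactCore_subset`; the inclusion holds for almost all `v`, §3). [cite: Rogawski1990, §4.3 pp. 43–44] -/
theorem torusTransport_apply_inH_eq_one (t : Measure (Subgroup.centralizer ({((cmDatum L N H).toLocal v g)} : Set ((cmDatum L N H).Local v)))) (h1 : t (compactCore (Subgroup.centralizer ({((cmDatum L N H).toLocal v g)} : Set ((cmDatum L N H).Local v)))) = 1)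
    (h : compactCore (Subgroup.centralizer ({((cmDatum L N H).toLocal v g)} : Set ((cmDatum L N H).Local v))) ⊆ Subtype.val ⁻¹' (cmLocalIntegralLevel L N H v : Set ((cmDatum L N H).Local v)))
    (t' : Measure (Subgroup.centralizer ({finAdelicEquiv (↥(maximalRealSubfield L)) L (IsCMField.complexConj L) N H (finPart (↥(maximalRealSubfield L)) L (IsCMField.complexConj L) N H g) v} : Set ↥(localPi L (IsCMField.complexConj L) N H v)))) (ht' : t' = Measure.map (subgroupCongrHomeomorph ψ.symm.toMulEquiv (Subgroup.centralizer ({((cmDatum L N H).toLocal v g)} : Set ((cmDatum L N H).Local v)))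
        (Subgroup.centralizer ({finAdelicEquiv (↥(maximalRealSubfield L)) L (IsCMField.complexConj L) N H (finPart (↥(maximalRealSubfield L)) L (IsCMField.complexConj L) N H g) v} : Set ↥(localPi L (IsCMField.complexConj L) N H v)))
        (localPiEquiv_symm_mem_centralizer_iff L N H v g ψ hψ) ψ.symm.continuous ψ.continuous) t) :
    t' ((inH (fun v => localInt L (IsCMField.complexConj L) N H v)
        (fun v => Subgroup.centralizer ({finAdelicEquiv (↥(maximalRealSubfield L)) L (IsCMField.complexConj L) N H
          (finPart (↥(maximalRealSubfield L)) L (IsCMField.complexConj L) N H g) v} : Set ↥(localPi L (IsCMField.complexConj L) N H v))) v :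
          Subgroup (Subgroup.centralizer ({finAdelicEquiv (↥(maximalRealSubfield L)) L (IsCMField.complexConj L) N H (finPart (↥(maximalRealSubfield L)) L (IsCMField.complexConj L) N H g) v} : Set ↥(localPi L (IsCMField.complexConj L) N H v)))) : Set (Subgroup.centralizer ({finAdelicEquiv (↥(maximalRealSubfield L)) L (IsCMField.complexConj L) N H (finPart (↥(maximalRealSubfield L)) L (IsCMField.complexConj L) N H g) v} : Set ↥(localPi L (IsCMField.complexConj L) N H v)))) = 1 := by
  haveI : IsClosed ((Subgroup.centralizer ({((cmDatum L N H).toLocal v g)} : Set ((cmDatum L N H).Local v))) : Set ((cmDatum L N H).Local v)) := isClosed_coe_centralizer_singleton _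
  rw [torusTransport_apply_inH L N H v g ψ hψ t t' ht']
  exact measure_preimage_eq_one_of_compactCore_subset _ t h1 (cmLocalIntegralLevel L N H v) (isCompact_isOpen_cmLocalIntegralLevel L N H v).1 h

end TransportD

section TransportE

variable [LocallyCompactSpace ↥(localPi L (IsCMField.complexConj L) N H v)] [SecondCountableTopology ↥(localPi L (IsCMField.complexConj L) N H v)]
  [MeasurableSpace (↥(localPi L (IsCMField.complexConj L) N H v) ⧸ Subgroup.centralizer ({finAdelicEquiv (↥(maximalRealSubfield L)) L (IsCMField.complexConj L) N H (finPart (↥(maximalRealSubfield L)) L (IsCMField.complexConj L) N H g) v} : Set ↥(localPi L (IsCMField.complexConj L) N H v)))]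
  [BorelSpace (↥(localPi L (IsCMField.complexConj L) N H v) ⧸ Subgroup.centralizer ({finAdelicEquiv (↥(maximalRealSubfield L)) L (IsCMField.complexConj L) N H (finPart (↥(maximalRealSubfield L)) L (IsCMField.complexConj L) N H g) v} : Set ↥(localPi L (IsCMField.complexConj L) N H v)))]

include hψ in
/-- §2e — **the `hm1` of ★ (b3)**: the model quotient measure `ν′ ∕ t′` gives the base set `π(U(𝒪_v))` mass ONE when `ν_v (U(H)(𝒪_v)) = 1`, `t` gives the
compact core of `C(g_v)` mass one and the compact core lies in `U(H)(𝒪_v)` (★ `quotientMeasure_image_mk_eq_one` on the model side, fed by §2c and §2d′).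
[cite: DeitmarEchterhoff2014, Thm. 1.5.3] [cite: Rogawski1990, §4.3 pp. 43–44] -/
theorem quotientMeasure_torusTransport_quotBase_eq_one (ν : Measure ((cmDatum L N H).Local v))
    (hK : ν (cmLocalIntegralLevel L N H v : Set ((cmDatum L N H).Local v)) = 1)
    (ν' : Measure ↥(localPi L (IsCMField.complexConj L) N H v)) [ν'.IsHaarMeasure] [ν'.IsMulRightInvariant] (hν' : ν' = Measure.map ψ.symm ν)
    (t : Measure (Subgroup.centralizer ({((cmDatum L N H).toLocal v g)} : Set ((cmDatum L N H).Local v)))) (h1 : t (compactCore (Subgroup.centralizer ({((cmDatum L N H).toLocal v g)} : Set ((cmDatum L N H).Local v)))) = 1)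
    (h : compactCore (Subgroup.centralizer ({((cmDatum L N H).toLocal v g)} : Set ((cmDatum L N H).Local v))) ⊆ Subtype.val ⁻¹' (cmLocalIntegralLevel L N H v : Set ((cmDatum L N H).Local v)))
    (t' : Measure (Subgroup.centralizer ({finAdelicEquiv (↥(maximalRealSubfield L)) L (IsCMField.complexConj L) N H (finPart (↥(maximalRealSubfield L)) L (IsCMField.complexConj L) N H g) v} : Set ↥(localPi L (IsCMField.complexConj L) N H v))))
    [t'.IsMulLeftInvariant] [IsFiniteMeasureOnCompacts t'] [t'.IsOpenPosMeasure] [t'.IsInvInvariant] [SFinite t']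
    (ht' : t' = Measure.map (subgroupCongrHomeomorph ψ.symm.toMulEquiv (Subgroup.centralizer ({((cmDatum L N H).toLocal v g)} : Set ((cmDatum L N H).Local v)))
        (Subgroup.centralizer ({finAdelicEquiv (↥(maximalRealSubfield L)) L (IsCMField.complexConj L) N H (finPart (↥(maximalRealSubfield L)) L (IsCMField.complexConj L) N H g) v} : Set ↥(localPi L (IsCMField.complexConj L) N H v)))
        (localPiEquiv_symm_mem_centralizer_iff L N H v g ψ hψ) ψ.symm.continuous ψ.continuous) t) :
    quotientMeasure (Subgroup.centralizer ({finAdelicEquiv (↥(maximalRealSubfield L)) L (IsCMField.complexConj L) N H (finPart (↥(maximalRealSubfield L)) L (IsCMField.complexConj L) N H g) v} : Set ↥(localPi L (IsCMField.complexConj L) N H v))) t' (isClosed_coe_centralizer_singleton _) ν'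
        (quotBase (fun v => localInt L (IsCMField.complexConj L) N H v)
        (fun v => Subgroup.centralizer ({finAdelicEquiv (↥(maximalRealSubfield L)) L (IsCMField.complexConj L) N H
          (finPart (↥(maximalRealSubfield L)) L (IsCMField.complexConj L) N H g) v} : Set ↥(localPi L (IsCMField.complexConj L) N H v))) v) = 1 := by
  haveI : IsClosed ((Subgroup.centralizer ({finAdelicEquiv (↥(maximalRealSubfield L)) L (IsCMField.complexConj L) N H (finPart (↥(maximalRealSubfield L)) L (IsCMField.complexConj L) N H g) v} : Set ↥(localPi L (IsCMField.complexConj L) N H v))) : Set ↥(localPi L (IsCMField.complexConj L) N H v)) := isClosed_coe_centralizer_singleton _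
  refine quotientMeasure_image_mk_eq_one _ t' ν' (localInt L (IsCMField.complexConj L) N H v) (isOpen_localInt L (IsCMField.complexConj L) N H v) ?_ ?_
  · subst hν'
    rw [map_localPiEquiv_symm_apply_localInt v ψ hψ ν, hK]
  · exact torusTransport_apply_inH_eq_one L N H v g ψ hψ t h1 h t' ht'

end TransportE

end Transport

/-! ## §3 The compact-core inclusion holds at almost every place -/

/-- **For `g = γ ⊗ 1` with `γ ∈ U(H)(L⁺)` regular, `compactCore C(g_v) ⊆ U(H)(𝒪_v)` for all but finitely many `v`** — ★ `CompactCoreCentralizerLevelAE L N H`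
read at `γ`, in `∃ S₀` form (the finite exceptional set the (b3) tower is cut along). [cite: Rogawski1990, §4.3 pp. 43–44] -/
theorem exists_finset_compactCore_centralizer_subset (hF : CompactCoreCentralizerLevelAE L N H) (γ : (cmDatum L N H).Rational)
    (hreg : Rogawski1990.IsRegularElt (γ.val : GL (Fin N) L)) :
    ∃ S₀ : Finset (HeightOneSpectrum (𝓞 ↥(maximalRealSubfield L))), ∀ v, v ∉ S₀ →
      compactCore (Subgroup.centralizer ({(cmDatum L N H).toLocal v ((cmDatum L N H).toAdelic γ)} : Set ((cmDatum L N H).Local v))) ⊆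
        Subtype.val ⁻¹' (cmLocalIntegralLevel L N H v : Set ((cmDatum L N H).Local v)) := by
  have h : ∀ᶠ v : HeightOneSpectrum (𝓞 ↥(maximalRealSubfield L)) in Filter.cofinite,
      compactCore (Subgroup.centralizer ({(cmDatum L N H).toLocal v ((cmDatum L N H).toAdelic γ)} : Set ((cmDatum L N H).Local v))) ⊆
        Subtype.val ⁻¹' (cmLocalIntegralLevel L N H v : Set ((cmDatum L N H).Local v)) := hF γ hreg
  rw [Filter.eventually_cofinite] at h
  exact ⟨h.toFinset, fun v hv => Classical.not_not.1 fun hv' => hv (h.mem_toFinset.2 hv')⟩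

/-- At a HERMITIAN NON-DEGENERATE `H` the inclusion needs no hypothesis (★ `compactCoreCentralizerLevelAE_of_hermitian`). [cite: Rogawski1990, §4.3 pp. 43–44] -/
theorem exists_finset_compactCore_centralizer_subset_of_hermitian (hH : (H.map (cmConjRingHom L))ᵀ = H) (hHd : H.det ≠ 0)
    (γ : (cmDatum L N H).Rational) (hreg : Rogawski1990.IsRegularElt (γ.val : GL (Fin N) L)) :
    ∃ S₀ : Finset (HeightOneSpectrum (𝓞 ↥(maximalRealSubfield L))), ∀ v, v ∉ S₀ →
      compactCore (Subgroup.centralizer ({(cmDatum L N H).toLocal v ((cmDatum L N H).toAdelic γ)} : Set ((cmDatum L N H).Local v))) ⊆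
        Subtype.val ⁻¹' (cmLocalIntegralLevel L N H v : Set ((cmDatum L N H).Local v)) :=
  exists_finset_compactCore_centralizer_subset L N H (compactCoreCentralizerLevelAE_of_hermitian L N H hH hHd) γ hreg

end UnitaryGroup

end Literature.NumberTheory.Automorphic

end
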